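import Literature.Geometry.Riemannian.ShrinkerEntropyAllScalesFlow
import HarnessLib

/-!
# Li–Wang 2020, towards Thm. 1.1 (all-scales LSI of a shrinker): integrations by parts with the
# potential, the `f`-moment along the weighted heat flow, and `∫ (Δ log u) u e^{-V}`

Third proof file towards `LiWang2020_shrinkerLSI_allScales_holds` (`ShrinkerEntropyAllScales.lean`;
Y. Li, B. Wang, *Heat kernel on Ricci shrinkers*, Calc. Var. PDE 59 (2020) = arXiv:1901.05691,
Thm. 1.1 / Prop. 5.9), continuing `ShrinkerEntropyAllScalesFlow.lean`. On a complete gradient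
shrinker `Ric + Hess f = g/2`, `R + |∇f|² = f` (so `R ≥ 0`, `f` proper, `Δf + R = n/2`,
`Δ_f f = n/2 − f`), with the shrinker measure `e^{-V} dV`, `dV = df`:

* `integral_mul_weightedLaplacian_potential`, `integral_potential_mul_weightedLaplacian` — Green's
  identities `∫ u (Lf) e^{-V} = −∫ g⁻¹(du, df) e^{-V}` and `∫ f (Lu) e^{-V} = −∫ g⁻¹(df, du) e^{-V}`
  with the (unbounded) potential on either side, for bounded `u` with bounded gradient / bounded `Lu`
  (the proper potential as exhaustion; `f e^{-V}, f² e^{-V} ∈ L¹`);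
* `continuousOn_potentialMoment`, `hasDerivAt_potentialMoment` — the `f`-moment
  `F(t) = ∫ f u(t) e^{-V}` along the weighted heat flow is continuous on `[0, ∞)` with
  `F' = (n/2) ∫ u e^{-V} − F` (the static-frame form of `d/dt ∫ f` in Li–Wang's Lemma 5.10);
* `integral_dalembertian_log_mul` — `∫ (Δ_g log u) u e^{-V} = −I(u) − (n/2)∫ u e^{-V} + ∫ f u e^{-V}`,
  tying the trace term of the Bochner formula to the Fisher information and the `f`-moment.

Theorems only; no definitions, no named facts (D-0026).

## References

* [LiWang2020] Y. Li, B. Wang, Calc. Var. PDE 59 (2020) no. 194 (arXiv:1901.05691): §5, Lemma 5.6,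
  Prop. 5.7 (proof), Prop. 5.9, Lemma 5.10 (arXiv pp. 18–20). READ (held text paper:arxiv-1901.05691).
* [CarrilloNi2009] J. A. Carrillo, L. Ni, Comm. Anal. Geom. 17 (2009), §4 (integration by parts on the
  complete soliton).
-/

noncomputable section

open Bundle Set Function Filter Module Manifold MeasureTheory
open scoped Manifold ContDiff Topology ENNReal NNReal

namespace Literature.Geometry.Riemannian

open Lorentzian Lorentzian.PseudoRiemannianMetric CarrilloNi2009_shrinkerLSI

universe uM

/-- `‖a b c‖ ≤ C ‖a c‖` when `|b| ≤ C` (reals). [folklore] -/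
theorem abs_mul_mul_le_of_abs_le {a b c C : ℝ} (h : |b| ≤ C) : ‖a * b * c‖ ≤ C * ‖a * c‖ := by
  rw [Real.norm_eq_abs, Real.norm_eq_abs, abs_mul, abs_mul, abs_mul]
  have h0 : 0 ≤ |a| * |c| := mul_nonneg (abs_nonneg _) (abs_nonneg _)
  calc |a| * |b| * |c| = |b| * (|a| * |c|) := by ring
    _ ≤ C * (|a| * |c|) := mul_le_mul_of_nonneg_right h h0

/-! ### Integrations by parts against the shrinker measure with the potential as test function -/

section ShrinkerGreen

variable {n : ℕ} {M : Type uM} [TopologicalSpace M] [T2Space M] [SecondCountableTopology M]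
  [ChartedSpace (EuclideanSpace ℝ (Fin n)) M] [IsManifold (𝓡 n) ∞ M]
  [T3Space M] [MeasurableSpace M] [BorelSpace M]
  {g : PseudoRiemannianMetric (𝓡 n) ∞ (EuclideanSpace ℝ (Fin n)) (TangentSpace (𝓡 n) : M → Type _)}
  [g.HasLeviCivita] {f : M → ℝ}

omit [T2Space M] [SecondCountableTopology M] [T3Space M] [MeasurableSpace M] [BorelSpace M]
  [IsManifold (𝓡 n) ∞ M] [g.HasLeviCivita] in
/-- `d(f + c) = df`. [folklore] -/
theorem mvfderiv_add_const_eq (hf : ContMDiff (𝓡 n) 𝓘(ℝ, ℝ) ∞ f) (c : ℝ) (x : M) :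
    mvfderiv (𝓡 n) (fun y ↦ f y + c) x = mvfderiv (𝓡 n) f x := by
  ext v
  have hh : HasDerivAt (fun t : ℝ ↦ t + c) 1 (f x) := (hasDerivAt_id _).add_const c
  have := mvfderiv_real_comp_apply (I := 𝓡 n) (h := fun t : ℝ ↦ t + c) hh
    (hf.mdifferentiableAt (by simp)) v
  simpa [Function.comp_def] using this

omit [T2Space M] [SecondCountableTopology M] [T3Space M] [MeasurableSpace M] [BorelSpace M] in
/-- `Hess(f + c) = Hess f`. [folklore] -/
theorem hessian_add_const_apply (hf : ContMDiff (𝓡 n) 𝓘(ℝ, ℝ) ∞ f) (c : ℝ) (x : M)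
    (X Y : TangentSpace (𝓡 n) x) :
    g.hessian (fun y ↦ f y + c) x X Y = g.hessian f x X Y := by
  have hf2 : ContMDiffAt (𝓡 n) 𝓘(ℝ, ℝ) 2 f x := (hf.of_le (WithTop.coe_le_coe.mpr le_top)).contMDiffAt
  have hζ : ContDiffAt ℝ 2 (fun t : ℝ ↦ t + c) (f x) := contDiffAt_id.add contDiffAt_const
  have h := g.hessian_real_comp (ζ := fun t : ℝ ↦ t + c) hf2 hζ X Y
  have hd1 : deriv (fun t : ℝ ↦ t + c) = fun _ ↦ 1 := by
    funext t; exact ((hasDerivAt_id t).add_const c).deriv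
  have hd2 : deriv (deriv (fun t : ℝ ↦ t + c)) (f x) = 0 := by rw [hd1, deriv_const]
  rw [show (fun y ↦ f y + c) = (fun t : ℝ ↦ t + c) ∘ f from rfl, h, hd2, hd1]
  ring

omit [T2Space M] [SecondCountableTopology M] [T3Space M] [MeasurableSpace M] [BorelSpace M] in
/-- `Lf = Δf − g⁻¹(dV, df) = n/2 − f` on a normalised shrinker when `dV = df`
(`R + Δf = n/2`, `R + |∇f|² = f`). [cite: LiWang2020, (1.2) and `Δf + R = n/2` (arXiv p. 20)] -/
theorem shrinker_weightedLaplacian_potential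
    (hsol : ∀ (x : M) (X Y : TangentSpace (𝓡 n) x),
      g.ricci x X Y + g.hessian f x X Y = (1 / 2 : ℝ) * g.val x X Y)
    (hnorm : ∀ x : M, g.scalarCurvature x + g.gradSq f x = f x) {V : M → ℝ}
    (hdV : ∀ x, mvfderiv (𝓡 n) V x = mvfderiv (𝓡 n) f x) (x : M) :
    g.dalembertian f x - g.innerDual x (mvfderiv (𝓡 n) V x : TangentSpace (𝓡 n) x →ₗ[ℝ] ℝ)
        (mvfderiv (𝓡 n) f x : TangentSpace (𝓡 n) x →ₗ[ℝ] ℝ) = n / 2 - f x := by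
  rw [hdV x, show g.innerDual x (mvfderiv (𝓡 n) f x : TangentSpace (𝓡 n) x →ₗ[ℝ] ℝ)
    (mvfderiv (𝓡 n) f x : TangentSpace (𝓡 n) x →ₗ[ℝ] ℝ) = g.gradSq f x from rfl]
  linarith [scalarCurvature_add_dalembertian hsol x, hnorm x]

omit [T2Space M] [SecondCountableTopology M] in
/-- **`∫ u (Lf) e^{-V} = −∫ g⁻¹(du, df) e^{-V}`** on a gradient shrinker (`Ric + Hess f = g/2`,
`R + |∇f|² = f`, `R ≥ 0`, proper `f`, weight `e^{-V}` with `dV = df`, `e^{-V}, f e^{-V} ∈ L¹`) for a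
bounded `C¹` function `u` with bounded gradient (Green's identity with the proper potential as
exhaustion; `|Δf| ≤ n/2 + f`, `|∇f|² ≤ f`, Cauchy–Schwarz for the cross term).
[cite: LiWang2020, Lemma 5.6 and proof of Prop. 5.7 (arXiv pp. 18–20)] -/
theorem integral_mul_weightedLaplacian_potential (hg : g.IsRiemannian)
    (hf : ContMDiff (𝓡 n) 𝓘(ℝ, ℝ) ∞ f)
    (hsol : ∀ (x : M) (X Y : TangentSpace (𝓡 n) x),
      g.ricci x X Y + g.hessian f x X Y = (1 / 2 : ℝ) * g.val x X Y)
    (hnorm : ∀ x : M, g.scalarCurvature x + g.gradSq f x = f x)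
    (hS : ∀ x, 0 ≤ g.scalarCurvature x) (hprop : ∀ c : ℝ, IsCompact {x | f x ≤ c})
    {V : M → ℝ} (hV : ContMDiff (𝓡 n) 𝓘(ℝ, ℝ) ∞ V) (hdV : ∀ x, mvfderiv (𝓡 n) V x = mvfderiv (𝓡 n) f x)
    (hw : Integrable (fun x ↦ Real.exp (-V x)) g.riemVolume)
    (hfw : Integrable (fun x ↦ f x * Real.exp (-V x)) g.riemVolume)
    {u : M → ℝ} (hu : ContMDiff (𝓡 n) 𝓘(ℝ, ℝ) 1 u) (huC : ∃ C, ∀ x, |u x| ≤ C)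
    (hdu : ∃ C, ∀ x, g.gradSq u x ≤ C) :
    ∫ x, u x * (g.dalembertian f x
        - g.innerDual x (mvfderiv (𝓡 n) V x : TangentSpace (𝓡 n) x →ₗ[ℝ] ℝ)
            (mvfderiv (𝓡 n) f x : TangentSpace (𝓡 n) x →ₗ[ℝ] ℝ)) * Real.exp (-V x) ∂g.riemVolume =
      -∫ x, g.innerDual x (mvfderiv (𝓡 n) u x : TangentSpace (𝓡 n) x →ₗ[ℝ] ℝ)
          (mvfderiv (𝓡 n) f x : TangentSpace (𝓡 n) x →ₗ[ℝ] ℝ) * Real.exp (-V x) ∂g.riemVolume := by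
  obtain ⟨Cu, hCu⟩ := huC
  obtain ⟨CG, hCG⟩ := hdu
  have hf1 : ContMDiff (𝓡 n) 𝓘(ℝ, ℝ) 1 f := hf.of_le (by norm_num)
  have hf2 : ContMDiff (𝓡 n) 𝓘(ℝ, ℝ) 2 f := hf.of_le (WithTop.coe_le_coe.mpr le_top)
  have hV1 : ContMDiff (𝓡 n) 𝓘(ℝ, ℝ) 1 V := hV.of_le (by norm_num)
  have hgradf : ∀ x, g.gradSq f x = f x - g.scalarCurvature x := fun x ↦ by linarith [hnorm x]
  have hΔf : ∀ x, g.dalembertian f x = n / 2 - g.scalarCurvature x := fun x ↦ by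
    linarith [scalarCurvature_add_dalembertian hsol x]
  have hf0 : ∀ x, 0 ≤ f x := fun x ↦ by linarith [hnorm x, hS x, g.gradSq_nonneg hg f x]
  have hgradle : ∀ x, g.gradSq f x ≤ f x := fun x ↦ by linarith [hgradf x, hS x]
  have hw0 : ∀ x, 0 ≤ Real.exp (-V x) := fun x ↦ (Real.exp_pos _).le
  have hwc : Continuous fun x ↦ Real.exp (-V x) := Real.continuous_exp.comp hV.continuous.neg
  have hff : ∀ x, g.innerDual x (mvfderiv (𝓡 n) f x : TangentSpace (𝓡 n) x →ₗ[ℝ] ℝ)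
      (mvfderiv (𝓡 n) f x : TangentSpace (𝓡 n) x →ₗ[ℝ] ℝ) = g.gradSq f x := fun x ↦ rfl
  -- the four integrability provisos
  have h1 : Integrable (fun x ↦ u x * g.dalembertian f x * Real.exp (-V x)) g.riemVolume := by
    have hc : Continuous fun x ↦ u x * g.dalembertian f x * Real.exp (-V x) :=
      (hu.continuous.mul (continuous_dalembertian g hf2)).mul hwc
    refine ((hw.const_mul (Cu * (n / 2))).add (hfw.const_mul Cu)).mono' hc.aestronglyMeasurable
      (Eventually.of_forall fun x ↦ ?_)
    have hΔ : |g.dalembertian f x| ≤ n / 2 + f x := by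
      rw [hΔf x, abs_le]; constructor <;> linarith [hS x, hf0 x, hgradle x, hgradf x,
        g.gradSq_nonneg hg f x, (by positivity : (0 : ℝ) ≤ n / 2)]
    rw [Real.norm_eq_abs, abs_mul, abs_mul, abs_of_nonneg (hw0 x), Pi.add_apply]
    have := mul_le_mul (hCu x) hΔ (abs_nonneg _) ((abs_nonneg _).trans (hCu x))
    nlinarith [hw0 x]
  have h2 : Integrable (fun x ↦ u x * g.innerDual x (mvfderiv (𝓡 n) V x : TangentSpace (𝓡 n) x →ₗ[ℝ] ℝ)
      (mvfderiv (𝓡 n) f x : TangentSpace (𝓡 n) x →ₗ[ℝ] ℝ) * Real.exp (-V x)) g.riemVolume := by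
    have hc : Continuous fun x ↦ u x * g.innerDual x (mvfderiv (𝓡 n) V x : TangentSpace (𝓡 n) x →ₗ[ℝ] ℝ)
        (mvfderiv (𝓡 n) f x : TangentSpace (𝓡 n) x →ₗ[ℝ] ℝ) * Real.exp (-V x) :=
      (hu.continuous.mul (continuous_innerDual_mvfderiv g hV1 hf1)).mul hwc
    refine (hfw.const_mul Cu).mono' hc.aestronglyMeasurable (Eventually.of_forall fun x ↦ ?_)
    rw [Real.norm_eq_abs, abs_mul, abs_mul, abs_of_nonneg (hw0 x), hdV x, hff,
      abs_of_nonneg (g.gradSq_nonneg hg f x)]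
    have := mul_le_mul (hCu x) (hgradle x) (g.gradSq_nonneg hg f x) ((abs_nonneg _).trans (hCu x))
    nlinarith [hw0 x]
  have h3 : Integrable (fun x ↦ g.innerDual x (mvfderiv (𝓡 n) u x : TangentSpace (𝓡 n) x →ₗ[ℝ] ℝ)
      (mvfderiv (𝓡 n) f x : TangentSpace (𝓡 n) x →ₗ[ℝ] ℝ) * Real.exp (-V x)) g.riemVolume := by
    have hc : Continuous fun x ↦ g.innerDual x (mvfderiv (𝓡 n) u x : TangentSpace (𝓡 n) x →ₗ[ℝ] ℝ)
        (mvfderiv (𝓡 n) f x : TangentSpace (𝓡 n) x →ₗ[ℝ] ℝ) * Real.exp (-V x) :=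
      (continuous_innerDual_mvfderiv g hu hf1).mul hwc
    refine (((hw.const_mul CG).add hfw).const_mul (1 / 2)).mono' hc.aestronglyMeasurable
      (Eventually.of_forall fun x ↦ ?_)
    have hcs := abs_innerDual_mvfderiv_le hg u f x
    rw [Real.norm_eq_abs, abs_mul, abs_of_nonneg (hw0 x), Pi.add_apply]
    nlinarith [hw0 x, hCG x, hgradle x]
  have h4 : Integrable (fun x ↦ u x * g.innerDual x (mvfderiv (𝓡 n) f x : TangentSpace (𝓡 n) x →ₗ[ℝ] ℝ)
      (mvfderiv (𝓡 n) f x : TangentSpace (𝓡 n) x →ₗ[ℝ] ℝ) * Real.exp (-V x)) g.riemVolume :=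
    h2.congr (Eventually.of_forall fun x ↦ by simp only [hdV x])
  exact integral_mul_weightedLaplacian_of_proper hg hf hprop hu hf2 hV1 h1 h2 h3 h4

omit [T2Space M] [SecondCountableTopology M] in
/-- **`∫ f (Lu) e^{-V} = −∫ g⁻¹(df, du) e^{-V}`** on a gradient shrinker (as above, with also
`f² e^{-V} ∈ L¹`) for a `C²` function `u` with bounded gradient and bounded `Lu` — the potential as
TEST function (Green's identity with the proper potential as exhaustion; `Δu = Lu + g⁻¹(df, du)`,
`|g⁻¹(df, du)| ≤ (f + |∇u|²)/2`). [cite: LiWang2020, Lemma 5.6 and proof of Prop. 5.7 (arXiv pp. 18–20)] -/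
theorem integral_potential_mul_weightedLaplacian (hg : g.IsRiemannian)
    (hf : ContMDiff (𝓡 n) 𝓘(ℝ, ℝ) ∞ f)
    (hnorm : ∀ x : M, g.scalarCurvature x + g.gradSq f x = f x)
    (hS : ∀ x, 0 ≤ g.scalarCurvature x) (hprop : ∀ c : ℝ, IsCompact {x | f x ≤ c})
    {V : M → ℝ} (hV : ContMDiff (𝓡 n) 𝓘(ℝ, ℝ) ∞ V) (hdV : ∀ x, mvfderiv (𝓡 n) V x = mvfderiv (𝓡 n) f x)
    (hw : Integrable (fun x ↦ Real.exp (-V x)) g.riemVolume)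
    (hfw : Integrable (fun x ↦ f x * Real.exp (-V x)) g.riemVolume)
    (hf2w : Integrable (fun x ↦ f x ^ 2 * Real.exp (-V x)) g.riemVolume)
    {u : M → ℝ} (hu : ContMDiff (𝓡 n) 𝓘(ℝ, ℝ) 2 u) {CG : ℝ} (hdu : ∀ x, g.gradSq u x ≤ CG)
    {CL : ℝ} (hLu : ∀ x, |g.dalembertian u x
      - g.innerDual x (mvfderiv (𝓡 n) V x : TangentSpace (𝓡 n) x →ₗ[ℝ] ℝ)
          (mvfderiv (𝓡 n) u x : TangentSpace (𝓡 n) x →ₗ[ℝ] ℝ)| ≤ CL) :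
    ∫ x, f x * (g.dalembertian u x
        - g.innerDual x (mvfderiv (𝓡 n) V x : TangentSpace (𝓡 n) x →ₗ[ℝ] ℝ)
            (mvfderiv (𝓡 n) u x : TangentSpace (𝓡 n) x →ₗ[ℝ] ℝ)) * Real.exp (-V x) ∂g.riemVolume =
      -∫ x, g.innerDual x (mvfderiv (𝓡 n) f x : TangentSpace (𝓡 n) x →ₗ[ℝ] ℝ)
          (mvfderiv (𝓡 n) u x : TangentSpace (𝓡 n) x →ₗ[ℝ] ℝ) * Real.exp (-V x) ∂g.riemVolume := by
  have hf1 : ContMDiff (𝓡 n) 𝓘(ℝ, ℝ) 1 f := hf.of_le (by norm_num)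
  have hu1 : ContMDiff (𝓡 n) 𝓘(ℝ, ℝ) 1 u := hu.of_le (by norm_num)
  have hV1 : ContMDiff (𝓡 n) 𝓘(ℝ, ℝ) 1 V := hV.of_le (by norm_num)
  have hgradf : ∀ x, g.gradSq f x = f x - g.scalarCurvature x := fun x ↦ by linarith [hnorm x]
  have hf0 : ∀ x, 0 ≤ f x := fun x ↦ by linarith [hnorm x, hS x, g.gradSq_nonneg hg f x]
  have hgradle : ∀ x, g.gradSq f x ≤ f x := fun x ↦ by linarith [hgradf x, hS x]
  have hw0 : ∀ x, 0 ≤ Real.exp (-V x) := fun x ↦ (Real.exp_pos _).le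
  have hwc : Continuous fun x ↦ Real.exp (-V x) := Real.continuous_exp.comp hV.continuous.neg
  set GVu : M → ℝ := fun x ↦ g.innerDual x (mvfderiv (𝓡 n) V x : TangentSpace (𝓡 n) x →ₗ[ℝ] ℝ)
      (mvfderiv (𝓡 n) u x : TangentSpace (𝓡 n) x →ₗ[ℝ] ℝ) with hGVudef
  set Gfu : M → ℝ := fun x ↦ g.innerDual x (mvfderiv (𝓡 n) f x : TangentSpace (𝓡 n) x →ₗ[ℝ] ℝ)
      (mvfderiv (𝓡 n) u x : TangentSpace (𝓡 n) x →ₗ[ℝ] ℝ) with hGfudef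
  have hGVu : ∀ x, GVu x = Gfu x := fun x ↦ by simp only [hGVudef, hGfudef, hdV x]
  have hcs : ∀ x, |Gfu x| ≤ (f x + CG) / 2 := fun x ↦
    (abs_innerDual_mvfderiv_le hg f u x).trans (by linarith [hgradle x, hdu x])
  have hΔu : ∀ x, |g.dalembertian u x| ≤ CL + (f x + CG) / 2 := fun x ↦ by
    have h1 : g.dalembertian u x = (g.dalembertian u x - GVu x) + Gfu x := by rw [hGVu x]; ring
    rw [h1]
    exact (abs_add_le _ _).trans (add_le_add (hLu x) (hcs x))
  have hGfuc : Continuous Gfu := continuous_innerDual_mvfderiv g hf1 hu1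
  have hGVuc : Continuous GVu := continuous_innerDual_mvfderiv g hV1 hu1
  -- the four integrability provisos
  have h1 : Integrable (fun x ↦ f x * g.dalembertian u x * Real.exp (-V x)) g.riemVolume := by
    have hc : Continuous fun x ↦ f x * g.dalembertian u x * Real.exp (-V x) :=
      (hf.continuous.mul (continuous_dalembertian g hu)).mul hwc
    refine (((hfw.const_mul (CL + CG / 2)).add (hf2w.const_mul (1 / 2)))).mono' hc.aestronglyMeasurable
      (Eventually.of_forall fun x ↦ ?_)
    rw [Real.norm_eq_abs, abs_mul, abs_mul, abs_of_nonneg (hw0 x), abs_of_nonneg (hf0 x), Pi.add_apply]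
    have := mul_le_mul_of_nonneg_left (hΔu x) (hf0 x)
    nlinarith [hw0 x]
  have h2 : Integrable (fun x ↦ f x * GVu x * Real.exp (-V x)) g.riemVolume := by
    have hc : Continuous fun x ↦ f x * GVu x * Real.exp (-V x) := (hf.continuous.mul hGVuc).mul hwc
    refine (((hf2w.const_mul (1 / 2)).add (hfw.const_mul (CG / 2)))).mono' hc.aestronglyMeasurable
      (Eventually.of_forall fun x ↦ ?_)
    rw [Real.norm_eq_abs, abs_mul, abs_mul, abs_of_nonneg (hw0 x), abs_of_nonneg (hf0 x), hGVu x,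
      Pi.add_apply]
    have := mul_le_mul_of_nonneg_left (hcs x) (hf0 x)
    nlinarith [hw0 x]
  have h3 : Integrable (fun x ↦ Gfu x * Real.exp (-V x)) g.riemVolume := by
    have hc : Continuous fun x ↦ Gfu x * Real.exp (-V x) := hGfuc.mul hwc
    refine (((hfw.const_mul (1 / 2)).add (hw.const_mul (CG / 2)))).mono' hc.aestronglyMeasurable
      (Eventually.of_forall fun x ↦ ?_)
    rw [Real.norm_eq_abs, abs_mul, abs_of_nonneg (hw0 x), Pi.add_apply]
    nlinarith [hw0 x, hcs x]
  have h4 : Integrable (fun x ↦ f x * Gfu x * Real.exp (-V x)) g.riemVolume :=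
    h2.congr (Eventually.of_forall fun x ↦ by simp only [hGVu x])
  exact integral_mul_weightedLaplacian_of_proper hg hf hprop hf1 hu hV1 h1 h2 h3 h4

end ShrinkerGreen

/-! ### Along the flow: the `f`-moment `F(t) = ∫ f u(t) e^{-V}` and the identity for `∫ (Δ log u) u` -/

section FlowMoments

variable {n : ℕ} {M : Type uM} [TopologicalSpace M] [T2Space M] [SecondCountableTopology M]
  [ChartedSpace (EuclideanSpace ℝ (Fin n)) M] [IsManifold (𝓡 n) ∞ M] [ConnectedSpace M]
  [T3Space M] [MeasurableSpace M] [BorelSpace M]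
  {g : PseudoRiemannianMetric (𝓡 n) ∞ (EuclideanSpace ℝ (Fin n)) (TangentSpace (𝓡 n) : M → Type _)}
  [g.HasLeviCivita] {f : M → ℝ}

omit [T2Space M] [SecondCountableTopology M] [ConnectedSpace M] [g.HasLeviCivita] in
/-- **The `f`-moment is continuous on `[0, ∞)`** along a family `u` jointly smooth on `M × [0, ∞)`
with `|u| ≤ Cu`, for `f e^{-V} ∈ L¹` (dominated convergence). [folklore] -/
theorem continuousOn_potentialMoment {V : M → ℝ} (hV : ContMDiff (𝓡 n) 𝓘(ℝ, ℝ) ∞ V)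
    (hf : ContMDiff (𝓡 n) 𝓘(ℝ, ℝ) ∞ f)
    (hfw : Integrable (fun x ↦ f x * Real.exp (-V x)) g.riemVolume) {u : ℝ → M → ℝ}
    (hu : ContMDiffOn ((𝓡 n).prod 𝓘(ℝ, ℝ)) 𝓘(ℝ, ℝ) ∞ (fun p : M × ℝ ↦ u p.2 p.1) (univ ×ˢ Ici 0))
    {Cu : ℝ} (hub : ∀ t ∈ Ici (0 : ℝ), ∀ x, |u t x| ≤ Cu) :
    ContinuousOn (fun s ↦ ∫ x, f x * u s x * Real.exp (-V x) ∂g.riemVolume) (Ici 0) := by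
  have hwc : Continuous fun x ↦ Real.exp (-V x) := Real.continuous_exp.comp hV.continuous.neg
  have hslice : ∀ s ∈ Ici (0 : ℝ), ContMDiff (𝓡 n) 𝓘(ℝ, ℝ) ∞ (u s) := fun s hs ↦
    hu.comp_contMDiff (contMDiff_id.prodMk contMDiff_const) fun y ↦ ⟨mem_univ _, hs⟩
  refine continuousOn_of_dominated (bound := fun x ↦ Cu * ‖f x * Real.exp (-V x)‖)
    (fun s hs ↦ ?_) (fun s hs ↦ Eventually.of_forall fun x ↦ ?_) (hfw.norm.const_mul Cu)
    (Eventually.of_forall fun x ↦ ?_)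
  · exact ((hf.continuous.mul (hslice s hs).continuous).mul hwc).aestronglyMeasurable
  · exact abs_mul_mul_le_of_abs_le (hub s hs x)
  · have hι : ContMDiff 𝓘(ℝ, ℝ) ((𝓡 n).prod 𝓘(ℝ, ℝ)) ∞ (fun s : ℝ ↦ (x, s)) :=
      contMDiff_const.prodMk contMDiff_id
    have hcomp : ContMDiffOn 𝓘(ℝ, ℝ) 𝓘(ℝ, ℝ) ∞ (fun s ↦ u s x) (Ici 0) :=
      hu.comp hι.contMDiffOn fun s hs ↦ ⟨mem_univ _, hs⟩
    exact (continuousOn_const.mul hcomp.continuousOn).mul continuousOn_const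

omit [T2Space M] [SecondCountableTopology M] [ConnectedSpace M] in
/-- **The `f`-moment evolves by `dF/dt = (n/2) ∫ u e^{-V} − F`** along a solution `u` of the weighted
heat flow `∂ₜu = Lu` on a gradient shrinker (`L = Δ − g⁻¹(dV, d·)`, `dV = df`), `u` jointly smooth
on `M × [0, ∞)` with `|u|`, `|∇u|²`, `|Lu|` bounded: Leibniz rule (bound `CL f e^{-V}`), then
`∫ f (Lu) e^{-V} = −∫ g⁻¹(df, du) e^{-V} = ∫ u (Lf) e^{-V}` (the potential on both sides of Green's
identity) and `Lf = n/2 − f`. This is `d/ds ∫ f ρ dv₀ = ∫ (Δ_f f) ρ dv₀` of the static-frame form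
of Li–Wang's Lemma 5.10. [cite: LiWang2020, Lemma 5.10 and proof of Prop. 5.7 (arXiv p. 20)] -/
theorem hasDerivAt_potentialMoment (hg : g.IsRiemannian) (hf : ContMDiff (𝓡 n) 𝓘(ℝ, ℝ) ∞ f)
    (hsol : ∀ (x : M) (X Y : TangentSpace (𝓡 n) x),
      g.ricci x X Y + g.hessian f x X Y = (1 / 2 : ℝ) * g.val x X Y)
    (hnorm : ∀ x : M, g.scalarCurvature x + g.gradSq f x = f x)
    (hS : ∀ x, 0 ≤ g.scalarCurvature x) (hprop : ∀ c : ℝ, IsCompact {x | f x ≤ c})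
    {V : M → ℝ} (hV : ContMDiff (𝓡 n) 𝓘(ℝ, ℝ) ∞ V) (hdV : ∀ x, mvfderiv (𝓡 n) V x = mvfderiv (𝓡 n) f x)
    (hw : Integrable (fun x ↦ Real.exp (-V x)) g.riemVolume)
    (hfw : Integrable (fun x ↦ f x * Real.exp (-V x)) g.riemVolume)
    (hf2w : Integrable (fun x ↦ f x ^ 2 * Real.exp (-V x)) g.riemVolume)
    {u : ℝ → M → ℝ}
    (hu : ContMDiffOn ((𝓡 n).prod 𝓘(ℝ, ℝ)) 𝓘(ℝ, ℝ) ∞ (fun p : M × ℝ ↦ u p.2 p.1) (univ ×ˢ Ici 0))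
    (heq : ∀ t ∈ Ici (0 : ℝ), ∀ x, derivWithin (fun s ↦ u s x) (Ici 0) t =
      g.dalembertian (u t) x - g.innerDual x (mvfderiv (𝓡 n) V x : TangentSpace (𝓡 n) x →ₗ[ℝ] ℝ)
        (mvfderiv (𝓡 n) (u t) x : TangentSpace (𝓡 n) x →ₗ[ℝ] ℝ))
    {Cu : ℝ} (hub : ∀ t ∈ Ici (0 : ℝ), ∀ x, |u t x| ≤ Cu)
    {CL : ℝ} (hLu : ∀ t ∈ Ici (0 : ℝ), ∀ x, |g.dalembertian (u t) x
      - g.innerDual x (mvfderiv (𝓡 n) V x : TangentSpace (𝓡 n) x →ₗ[ℝ] ℝ)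
          (mvfderiv (𝓡 n) (u t) x : TangentSpace (𝓡 n) x →ₗ[ℝ] ℝ)| ≤ CL)
    {CG : ℝ} (hGu : ∀ t ∈ Ici (0 : ℝ), ∀ x, g.gradSq (u t) x ≤ CG) {t : ℝ} (ht : 0 < t) :
    HasDerivAt (fun s ↦ ∫ x, f x * u s x * Real.exp (-V x) ∂g.riemVolume)
      ((n : ℝ) / 2 * (∫ x, u t x * Real.exp (-V x) ∂g.riemVolume)
        - ∫ x, f x * u t x * Real.exp (-V x) ∂g.riemVolume) t := by
  set w : M → ℝ := fun x ↦ Real.exp (-V x) with hwdef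
  have hwc : Continuous w := Real.continuous_exp.comp hV.continuous.neg
  have hw0 : ∀ x, 0 ≤ w x := fun x ↦ (Real.exp_pos _).le
  have hV1 : ContMDiff (𝓡 n) 𝓘(ℝ, ℝ) 1 V := hV.of_le (by norm_num)
  have hf1 : ContMDiff (𝓡 n) 𝓘(ℝ, ℝ) 1 f := hf.of_le (by norm_num)
  have hf0 : ∀ x, 0 ≤ f x := fun x ↦ by linarith [hnorm x, hS x, g.gradSq_nonneg hg f x]
  have hslice : ∀ s ∈ Ici (0 : ℝ), ContMDiff (𝓡 n) 𝓘(ℝ, ℝ) ∞ (u s) := fun s hs ↦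
    hu.comp_contMDiff (contMDiff_id.prodMk contMDiff_const) fun y ↦ ⟨mem_univ _, hs⟩
  set Lu : ℝ → M → ℝ := fun s x ↦ g.dalembertian (u s) x
      - g.innerDual x (mvfderiv (𝓡 n) V x : TangentSpace (𝓡 n) x →ₗ[ℝ] ℝ)
          (mvfderiv (𝓡 n) (u s) x : TangentSpace (𝓡 n) x →ₗ[ℝ] ℝ) with hLudef
  have hLuc : ∀ s ∈ Ici (0 : ℝ), Continuous (Lu s) := fun s hs ↦
    (continuous_dalembertian g ((hslice s hs).of_le (WithTop.coe_le_coe.mpr le_top))).sub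
      (continuous_innerDual_mvfderiv g hV1 ((hslice s hs).of_le (by norm_num)))
  -- the Leibniz rule
  set F : ℝ → M → ℝ := fun s x ↦ f x * u s x * w x with hFdef
  set F' : ℝ → M → ℝ := fun s x ↦ f x * derivWithin (fun r ↦ u r x) (Ici 0) s * w x with hF'def
  have hmain := hasDerivAt_integral_of_dominated_loc_of_deriv_le (μ := g.riemVolume) (F := F)
    (F' := F') (x₀ := t) (s := Ioi 0) (bound := fun x ↦ CL * (f x * w x)) (Ioi_mem_nhds ht)
    ?_ ?_ ?_ ?_ (hfw.const_mul _) ?_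
  rotate_left
  · filter_upwards [Ioi_mem_nhds ht] with s hs
    have hs' : s ∈ Ici (0 : ℝ) := mem_Ici.2 (le_of_lt (mem_Ioi.1 hs))
    exact ((hf.continuous.mul (hslice s hs').continuous).mul hwc).aestronglyMeasurable
  · have ht' : t ∈ Ici (0 : ℝ) := le_of_lt ht
    refine (hfw.norm.const_mul Cu).mono' ((hf.continuous.mul (hslice t ht').continuous).mul
      hwc).aestronglyMeasurable (Eventually.of_forall fun x ↦ ?_)
    simp only [hFdef]
    exact abs_mul_mul_le_of_abs_le (hub t ht' x)
  · have ht' : t ∈ Ici (0 : ℝ) := le_of_lt ht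
    have hF't : F' t = fun x ↦ f x * Lu t x * w x := by
      funext x; simp only [hF'def, hLudef, heq t ht' x]
    rw [hF't]
    exact ((hf.continuous.mul (hLuc t ht')).mul hwc).aestronglyMeasurable
  · refine Eventually.of_forall fun x s hs ↦ ?_
    have hs' : s ∈ Ici (0 : ℝ) := mem_Ici.2 (le_of_lt (mem_Ioi.1 hs))
    simp only [hF'def, heq s hs' x]
    rw [Real.norm_eq_abs, abs_mul, abs_mul, abs_of_nonneg (hw0 x), abs_of_nonneg (hf0 x)]
    have := hLu s hs' x
    have : f x * |Lu s x| ≤ f x * CL := mul_le_mul_of_nonneg_left this (hf0 x)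
    nlinarith [hw0 x]
  · refine Eventually.of_forall fun x s hs ↦ ?_
    have hs' : s ∈ Ici (0 : ℝ) := mem_Ici.2 (le_of_lt (mem_Ioi.1 hs))
    have hd : HasDerivAt (fun r ↦ u r x) (derivWithin (fun r ↦ u r x) (Ici 0) s) s :=
      (hasDerivWithinAt_time_of_contMDiffOn (k := ∞) (by simp) hu x hs').hasDerivAt
        (Ici_mem_nhds hs)
    exact (hd.const_mul (f x)).mul_const (w x)
  -- the value of the derivative
  have ht' : t ∈ Ici (0 : ℝ) := le_of_lt ht
  refine hmain.2.congr_deriv ?_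
  have hut : ContMDiff (𝓡 n) 𝓘(ℝ, ℝ) ∞ (u t) := hslice t ht'
  have hut1 : ContMDiff (𝓡 n) 𝓘(ℝ, ℝ) 1 (u t) := hut.of_le (by norm_num)
  have hut2 : ContMDiff (𝓡 n) 𝓘(ℝ, ℝ) 2 (u t) := hut.of_le (WithTop.coe_le_coe.mpr le_top)
  have hL : ∫ x, F' t x ∂g.riemVolume = ∫ x, f x * Lu t x * Real.exp (-V x) ∂g.riemVolume := by
    refine integral_congr_ae (Eventually.of_forall fun x ↦ ?_)
    simp only [hF'def, heq t ht' x, hwdef, hLudef]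
  -- `∫ f (Lu) e^{-V} = −∫ g⁻¹(df, du) e^{-V} = ∫ u (Lf) e^{-V}`
  have hA := integral_potential_mul_weightedLaplacian hg hf hnorm hS hprop hV hdV hw hfw hf2w hut2
    (hGu t ht') (hLu t ht')
  have hB := integral_mul_weightedLaplacian_potential hg hf hsol hnorm hS hprop hV hdV hw hfw hut1
    ⟨Cu, hub t ht'⟩ ⟨CG, hGu t ht'⟩
  have hsymm : ∫ x, g.innerDual x (mvfderiv (𝓡 n) f x : TangentSpace (𝓡 n) x →ₗ[ℝ] ℝ)
      (mvfderiv (𝓡 n) (u t) x : TangentSpace (𝓡 n) x →ₗ[ℝ] ℝ) * Real.exp (-V x) ∂g.riemVolume =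
      ∫ x, g.innerDual x (mvfderiv (𝓡 n) (u t) x : TangentSpace (𝓡 n) x →ₗ[ℝ] ℝ)
        (mvfderiv (𝓡 n) f x : TangentSpace (𝓡 n) x →ₗ[ℝ] ℝ) * Real.exp (-V x) ∂g.riemVolume :=
    integral_congr_ae (Eventually.of_forall fun x ↦ by dsimp only; rw [g.innerDual_comm])
  have hLf := shrinker_weightedLaplacian_potential hsol hnorm hdV
  have hC : ∫ x, u t x * (g.dalembertian f x
      - g.innerDual x (mvfderiv (𝓡 n) V x : TangentSpace (𝓡 n) x →ₗ[ℝ] ℝ)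
          (mvfderiv (𝓡 n) f x : TangentSpace (𝓡 n) x →ₗ[ℝ] ℝ)) * Real.exp (-V x) ∂g.riemVolume =
      (n : ℝ) / 2 * (∫ x, u t x * Real.exp (-V x) ∂g.riemVolume)
        - ∫ x, f x * u t x * Real.exp (-V x) ∂g.riemVolume := by
    have hpt : ∀ x, u t x * (g.dalembertian f x
        - g.innerDual x (mvfderiv (𝓡 n) V x : TangentSpace (𝓡 n) x →ₗ[ℝ] ℝ)
            (mvfderiv (𝓡 n) f x : TangentSpace (𝓡 n) x →ₗ[ℝ] ℝ)) * Real.exp (-V x) =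
        (n : ℝ) / 2 * (u t x * Real.exp (-V x)) - f x * u t x * Real.exp (-V x) := fun x ↦ by
      rw [hLf x]; ring
    have i1 : Integrable (fun x ↦ (n : ℝ) / 2 * (u t x * Real.exp (-V x))) g.riemVolume :=
      (integrable_mul_weight hut.continuous ⟨Cu, hub t ht'⟩ hw).const_mul _
    have i2 : Integrable (fun x ↦ f x * u t x * Real.exp (-V x)) g.riemVolume := by
      refine (hfw.norm.const_mul Cu).mono' ((hf.continuous.mul hut.continuous).mul
        hwc).aestronglyMeasurable (Eventually.of_forall fun x ↦ ?_)
      exact abs_mul_mul_le_of_abs_le (hub t ht' x)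
    simp_rw [hpt]
    rw [integral_sub i1 i2, integral_const_mul]
  rw [hL]
  simp only [hLudef] at hA ⊢
  rw [hA, hsymm, ← hB, hC]

/-- **`∫ (Δ_g log u) u e^{-V} = −I(u) − (n/2) ∫ u e^{-V} + ∫ f u e^{-V}`** on a complete gradient
shrinker, for a smooth `u` with values in `[a, b]`, `a > 0`, bounded gradient and bounded `Lu`
(`Δ_g log u = −|∇u|²/u² + Δu/u`, `Δu = Lu + g⁻¹(df, du)`, `∫ Lu e^{-V} = 0`,
`∫ g⁻¹(df, du) e^{-V} = −∫ u (Lf) e^{-V} = −(n/2)∫ u e^{-V} + ∫ f u e^{-V}`): the identity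
`∫ ρ Δ log ρ dv₀ = −(I − F + n/2)` that ties the trace term of the Bochner formula to the
`f`-moment in the static-frame Perelman computation.
[cite: LiWang2020, proof of Prop. 5.7 (`Δf + R = n/2`, `Δ_f f`) and Lemma 5.10 (arXiv p. 20)] -/
theorem integral_dalembertian_log_mul (hg : g.IsRiemannian)
    (hc : ∀ (x : M) (r : NNReal), IsCompact {y : M | g.edist hg x y ≤ r})
    (hf : ContMDiff (𝓡 n) 𝓘(ℝ, ℝ) ∞ f)
    (hsol : ∀ (x : M) (X Y : TangentSpace (𝓡 n) x),
      g.ricci x X Y + g.hessian f x X Y = (1 / 2 : ℝ) * g.val x X Y)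
    (hnorm : ∀ x : M, g.scalarCurvature x + g.gradSq f x = f x)
    (hS : ∀ x, 0 ≤ g.scalarCurvature x) (hprop : ∀ c : ℝ, IsCompact {x | f x ≤ c})
    {V : M → ℝ} (hV : ContMDiff (𝓡 n) 𝓘(ℝ, ℝ) ∞ V) (hdV : ∀ x, mvfderiv (𝓡 n) V x = mvfderiv (𝓡 n) f x)
    (hw : Integrable (fun x ↦ Real.exp (-V x)) g.riemVolume)
    (hfw : Integrable (fun x ↦ f x * Real.exp (-V x)) g.riemVolume)
    {u : M → ℝ} (hu : ContMDiff (𝓡 n) 𝓘(ℝ, ℝ) ∞ u) {a b : ℝ} (ha : 0 < a)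
    (hab : ∀ x, a ≤ u x ∧ u x ≤ b) {CL : ℝ} (hLu : ∀ x, |g.dalembertian u x
      - g.innerDual x (mvfderiv (𝓡 n) V x : TangentSpace (𝓡 n) x →ₗ[ℝ] ℝ)
          (mvfderiv (𝓡 n) u x : TangentSpace (𝓡 n) x →ₗ[ℝ] ℝ)| ≤ CL)
    {CG : ℝ} (hGu : ∀ x, g.gradSq u x ≤ CG) :
    ∫ x, g.dalembertian (fun y ↦ Real.log (u y)) x * u x * Real.exp (-V x) ∂g.riemVolume =
      -(∫ x, g.gradSq u x / u x * Real.exp (-V x) ∂g.riemVolume)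
        - (n : ℝ) / 2 * (∫ x, u x * Real.exp (-V x) ∂g.riemVolume)
        + ∫ x, f x * u x * Real.exp (-V x) ∂g.riemVolume := by
  have hw0 : ∀ x, 0 ≤ Real.exp (-V x) := fun x ↦ (Real.exp_pos _).le
  have hwc : Continuous fun x ↦ Real.exp (-V x) := Real.continuous_exp.comp hV.continuous.neg
  have hV1 : ContMDiff (𝓡 n) 𝓘(ℝ, ℝ) 1 V := hV.of_le (by norm_num)
  have hf1 : ContMDiff (𝓡 n) 𝓘(ℝ, ℝ) 1 f := hf.of_le (by norm_num)
  have hu1 : ContMDiff (𝓡 n) 𝓘(ℝ, ℝ) 1 u := hu.of_le (by norm_num)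
  have hu2 : ContMDiff (𝓡 n) 𝓘(ℝ, ℝ) 2 u := hu.of_le (WithTop.coe_le_coe.mpr le_top)
  have hupos : ∀ x, 0 < u x := fun x ↦ ha.trans_le (hab x).1
  have hub : ∃ C, ∀ x, |u x| ≤ C := ⟨max |a| |b|, fun x ↦ abs_le_max_abs_abs (hab x).1 (hab x).2⟩
  -- `Δ log u = |∇u|²·(−1/u²) + (1/u) Δu`
  have hΔlog : ∀ x, g.dalembertian (fun y ↦ Real.log (u y)) x * u x =
      -(g.gradSq u x / u x) + g.dalembertian u x := by
    intro x
    have hne : u x ≠ 0 := (hupos x).ne'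
    have hux2 : ContMDiffAt (𝓡 n) 𝓘(ℝ, ℝ) 2 u x := hu2.contMDiffAt
    have hζ : ContDiffAt ℝ 2 Real.log (u x) := Real.contDiffAt_log.2 hne
    have h := g.dalembertian_real_comp (ζ := Real.log) hux2 hζ
    have hd1 : deriv Real.log (u x) = (u x)⁻¹ := Real.deriv_log (u x)
    have hd2 : deriv (deriv Real.log) (u x) = -((u x) ^ 2)⁻¹ := by
      rw [Real.deriv_log']
      exact (hasDerivAt_inv hne).deriv
    rw [show (fun y ↦ Real.log (u y)) = Real.log ∘ u from rfl, h, hd1, hd2,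
      show g.innerDual x (mvfderiv (𝓡 n) u x : TangentSpace (𝓡 n) x →ₗ[ℝ] ℝ)
        (mvfderiv (𝓡 n) u x : TangentSpace (𝓡 n) x →ₗ[ℝ] ℝ) = g.gradSq u x from rfl]
    field_simp
  -- `∫ (Lu) e^{-V} = 0`
  have hLint : ∫ x, (1 : ℝ) * (g.dalembertian u x
      - g.innerDual x (mvfderiv (𝓡 n) V x : TangentSpace (𝓡 n) x →ₗ[ℝ] ℝ)
          (mvfderiv (𝓡 n) u x : TangentSpace (𝓡 n) x →ₗ[ℝ] ℝ)) * Real.exp (-V x) ∂g.riemVolume = 0 := by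
    have h := integral_mul_weightedLaplacian_complete hg hc (a := fun _ ↦ (1 : ℝ)) (b := u)
      contMDiff_const hu2 hV1 hw ⟨1, fun x ↦ by simp⟩ ⟨0, fun x ↦ by
        rw [g.gradSq_eq_zero_of_mvfderiv_eq_zero (mvfderiv_const (1 : ℝ))]⟩ ⟨CG, hGu⟩ ⟨CL, hLu⟩
    rw [h]
    have h0 : ∀ x : M, mvfderiv (𝓡 n) (fun _ : M ↦ (1 : ℝ)) x = 0 := fun x ↦ mvfderiv_const (1 : ℝ)
    simp [h0, PseudoRiemannianMetric.innerDual]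
  -- `∫ g⁻¹(dV, du) e^{-V} = −(n/2) ∫ u e^{-V} + ∫ f u e^{-V}`
  have hB := integral_mul_weightedLaplacian_potential hg hf hsol hnorm hS hprop hV hdV hw hfw hu1
    hub ⟨CG, hGu⟩
  have hLf := shrinker_weightedLaplacian_potential hsol hnorm hdV
  have i_uw : Integrable (fun x ↦ u x * Real.exp (-V x)) g.riemVolume :=
    integrable_mul_weight hu.continuous hub hw
  obtain ⟨Cu, hCu⟩ := hub
  have i_fuw : Integrable (fun x ↦ f x * u x * Real.exp (-V x)) g.riemVolume := by
    refine (hfw.norm.const_mul Cu).mono' ((hf.continuous.mul hu.continuous).mul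
      hwc).aestronglyMeasurable (Eventually.of_forall fun x ↦ ?_)
    exact abs_mul_mul_le_of_abs_le (hCu x)
  have hBval : ∫ x, g.innerDual x (mvfderiv (𝓡 n) V x : TangentSpace (𝓡 n) x →ₗ[ℝ] ℝ)
      (mvfderiv (𝓡 n) u x : TangentSpace (𝓡 n) x →ₗ[ℝ] ℝ) * Real.exp (-V x) ∂g.riemVolume =
      -((n : ℝ) / 2 * (∫ x, u x * Real.exp (-V x) ∂g.riemVolume))
        + ∫ x, f x * u x * Real.exp (-V x) ∂g.riemVolume := by
    have h1 : ∫ x, g.innerDual x (mvfderiv (𝓡 n) V x : TangentSpace (𝓡 n) x →ₗ[ℝ] ℝ)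
        (mvfderiv (𝓡 n) u x : TangentSpace (𝓡 n) x →ₗ[ℝ] ℝ) * Real.exp (-V x) ∂g.riemVolume =
        ∫ x, g.innerDual x (mvfderiv (𝓡 n) u x : TangentSpace (𝓡 n) x →ₗ[ℝ] ℝ)
          (mvfderiv (𝓡 n) f x : TangentSpace (𝓡 n) x →ₗ[ℝ] ℝ) * Real.exp (-V x) ∂g.riemVolume :=
      integral_congr_ae (Eventually.of_forall fun x ↦ by dsimp only; rw [hdV x, g.innerDual_comm])
    have h2 : ∫ x, u x * (g.dalembertian f x
        - g.innerDual x (mvfderiv (𝓡 n) V x : TangentSpace (𝓡 n) x →ₗ[ℝ] ℝ)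
            (mvfderiv (𝓡 n) f x : TangentSpace (𝓡 n) x →ₗ[ℝ] ℝ)) * Real.exp (-V x) ∂g.riemVolume =
        (n : ℝ) / 2 * (∫ x, u x * Real.exp (-V x) ∂g.riemVolume)
          - ∫ x, f x * u x * Real.exp (-V x) ∂g.riemVolume := by
      have hpt : ∀ x, u x * (g.dalembertian f x
          - g.innerDual x (mvfderiv (𝓡 n) V x : TangentSpace (𝓡 n) x →ₗ[ℝ] ℝ)
              (mvfderiv (𝓡 n) f x : TangentSpace (𝓡 n) x →ₗ[ℝ] ℝ)) * Real.exp (-V x) =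
          (n : ℝ) / 2 * (u x * Real.exp (-V x)) - f x * u x * Real.exp (-V x) := fun x ↦ by
        rw [hLf x]; ring
      simp_rw [hpt]
      rw [integral_sub (i_uw.const_mul _) i_fuw, integral_const_mul]
    rw [h1]
    linarith [hB, h2]
  -- assemble: `(Δ log u) u = −|∇u|²/u + Lu + g⁻¹(dV, du)`
  have hpt : ∀ x, g.dalembertian (fun y ↦ Real.log (u y)) x * u x * Real.exp (-V x) =
      -(g.gradSq u x / u x * Real.exp (-V x))
        + (1 : ℝ) * (g.dalembertian u x
            - g.innerDual x (mvfderiv (𝓡 n) V x : TangentSpace (𝓡 n) x →ₗ[ℝ] ℝ)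
                (mvfderiv (𝓡 n) u x : TangentSpace (𝓡 n) x →ₗ[ℝ] ℝ)) * Real.exp (-V x)
        + g.innerDual x (mvfderiv (𝓡 n) V x : TangentSpace (𝓡 n) x →ₗ[ℝ] ℝ)
            (mvfderiv (𝓡 n) u x : TangentSpace (𝓡 n) x →ₗ[ℝ] ℝ) * Real.exp (-V x) := fun x ↦ by
    rw [hΔlog x]; ring
  -- integrability of the three pieces
  have hQc : Continuous (fun x ↦ g.gradSq u x / u x) :=
    (contMDiff_gradSq g hu).continuous.div hu.continuous fun x ↦ (hupos x).ne'
  have iQ : Integrable (fun x ↦ g.gradSq u x / u x * Real.exp (-V x)) g.riemVolume :=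
    integrable_mul_weight hQc ⟨CG / a, fun x ↦ by
      rw [abs_of_nonneg (div_nonneg (g.gradSq_nonneg hg u x) (hupos x).le)]
      exact div_le_div₀ ((g.gradSq_nonneg hg u x).trans (hGu x)) (hGu x) ha (hab x).1⟩ hw
  have hLc : Continuous (fun x ↦ g.dalembertian u x
      - g.innerDual x (mvfderiv (𝓡 n) V x : TangentSpace (𝓡 n) x →ₗ[ℝ] ℝ)
          (mvfderiv (𝓡 n) u x : TangentSpace (𝓡 n) x →ₗ[ℝ] ℝ)) :=
    (continuous_dalembertian g hu2).sub (continuous_innerDual_mvfderiv g hV1 hu1)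
  have iL : Integrable (fun x ↦ (1 : ℝ) * (g.dalembertian u x
      - g.innerDual x (mvfderiv (𝓡 n) V x : TangentSpace (𝓡 n) x →ₗ[ℝ] ℝ)
          (mvfderiv (𝓡 n) u x : TangentSpace (𝓡 n) x →ₗ[ℝ] ℝ)) * Real.exp (-V x)) g.riemVolume := by
    have := integrable_mul_weight hLc ⟨CL, hLu⟩ hw
    exact this.congr (Eventually.of_forall fun x ↦ by ring)
  have hGc : Continuous (fun x ↦ g.innerDual x (mvfderiv (𝓡 n) V x : TangentSpace (𝓡 n) x →ₗ[ℝ] ℝ)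
      (mvfderiv (𝓡 n) u x : TangentSpace (𝓡 n) x →ₗ[ℝ] ℝ)) := continuous_innerDual_mvfderiv g hV1 hu1
  have hgradf : ∀ x, g.gradSq f x = f x - g.scalarCurvature x := fun x ↦ by linarith [hnorm x]
  have hf0 : ∀ x, 0 ≤ f x := fun x ↦ by linarith [hnorm x, hS x, g.gradSq_nonneg hg f x]
  have hgradle : ∀ x, g.gradSq f x ≤ f x := fun x ↦ by linarith [hgradf x, hS x]
  have iG : Integrable (fun x ↦ g.innerDual x (mvfderiv (𝓡 n) V x : TangentSpace (𝓡 n) x →ₗ[ℝ] ℝ)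
      (mvfderiv (𝓡 n) u x : TangentSpace (𝓡 n) x →ₗ[ℝ] ℝ) * Real.exp (-V x)) g.riemVolume := by
    refine (((hfw.const_mul (1 / 2)).add (hw.const_mul (CG / 2)))).mono' (hGc.mul hwc).aestronglyMeasurable
      (Eventually.of_forall fun x ↦ ?_)
    have hcs := abs_innerDual_mvfderiv_le hg f u x
    rw [Real.norm_eq_abs, abs_mul, abs_of_nonneg (hw0 x), Pi.add_apply, hdV x]
    nlinarith [hw0 x, hGu x, hgradle x]
  have iQ' : Integrable (fun x ↦ -(g.gradSq u x / u x * Real.exp (-V x))) g.riemVolume := iQ.neg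
  have iQL : Integrable (fun x ↦ -(g.gradSq u x / u x * Real.exp (-V x))
      + (1 : ℝ) * (g.dalembertian u x
          - g.innerDual x (mvfderiv (𝓡 n) V x : TangentSpace (𝓡 n) x →ₗ[ℝ] ℝ)
              (mvfderiv (𝓡 n) u x : TangentSpace (𝓡 n) x →ₗ[ℝ] ℝ)) * Real.exp (-V x)) g.riemVolume :=
    iQ'.add iL
  simp_rw [hpt]
  rw [integral_add iQL iG, integral_add iQ' iL, integral_neg, hLint, hBval]
  ring

end FlowMoments

end Literature.Geometry.Riemannian

end
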